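import Literature.AlgebraicGeometry.ShimuraVarieties.UnitaryBallQuotientDatum
import Literature.GroupTheory.ArithmeticGroups.MinkowskiTorsionFree
import HarnessLib

/-!
# Principal congruence subgroups of level `n ≥ 3` are torsion-free

Family `hodge`, layer `Literature/AlgebraicGeometry/ShimuraVarieties`; theorems only (no definition,
no named fact; D-0026). The hypothesis structure `UnitaryBallQuotientDatum`
(`ShimuraVarieties/UnitaryBallQuotientDatum`, [BergeronMillsonMoeglin2016Balls, Part 2 §1.4]: "`K`
neat, whence `Γ` torsion free") carries a field `torsionFree : ∀ γ ∈ Γ, IsOfFinOrder γ → γ = 1` for a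
congruence subgroup `Γ` of `U(V)(F) ≤ GL_m(E)`, `E` a CM number field. By MINKOWSKI's lemma
([Minkowski1887, §1]; `GroupTheory/ArithmeticGroups/MinkowskiTorsionFree`, number-field form
`Matrix.eq_one_of_pow_eq_one_of_exists_eq_one_add_smul_map`) this holds for every subgroup of a
principal congruence subgroup `Γ(n) = {g | g ≡ 1 (mod n) integrally}` with `n ≥ 3` — the level
taken in [Deligne1982HodgeCycles, proof of Thm. 4.8, p. 50] ("let `n` be an integer `≥ 3`") and in
[MumfordFogartyKirwan1994, Ch. 7 §3, remark after Thm. 7.9] ("lemma of Serre"):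

* `IsCongruentOneMod.eq_one_of_pow_eq_one` / `…_of_isOfFinOrder` — a matrix over a number field,
  `≡ 1 (mod n)` integrally (`IsCongruentOneMod n g`), of finite order, `n ≥ 3` ⟹ `g = 1`;
* `torsionFree_principalCongruenceSubgroup` — `Γ(n) = principalCongruenceSubgroup σ H n` is
  torsion-free for `n ≥ 3`;
* `torsionFree_of_le_principalCongruenceSubgroup` — so is every `Γ ≤ Γ(n)`.

## References

* [Minkowski1887] H. Minkowski, J. reine angew. Math. 101 (1887), 196–202, §1.
* [BergeronMillsonMoeglin2016Balls] N. Bergeron, J. Millson, C. Moeglin, Acta Math. 216 (2016),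
  Part 2 §1.4.
* [Deligne1982HodgeCycles] P. Deligne, LNM 900 (1982), proof of Thm. 4.8, p. 50.
* [MumfordFogartyKirwan1994] D. Mumford, J. Fogarty, F. Kirwan, GIT, 3rd ed., Ch. 7 §3.
-/

namespace Literature.AlgebraicGeometry.ShimuraVarieties

open NumberField

variable {E : Type*} [Field E] [NumberField E] {m : Type*} [Fintype m] [DecidableEq m]

/-- **Minkowski, number-field form**: `g ≡ 1 (mod n)` integrally, `g ^ k = 1` (`k > 0`), `n ≥ 3`
⟹ `g = 1`. [cite: Minkowski1887, §1] -/
theorem IsCongruentOneMod.eq_one_of_pow_eq_one {n : ℕ} (hn : 3 ≤ n) {g : Matrix m m E}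
    (hg : IsCongruentOneMod n g) {k : ℕ} (hk : 0 < k) (hgk : g ^ k = 1) : g = 1 :=
  Literature.GroupTheory.ArithmeticGroups.Matrix.eq_one_of_pow_eq_one_of_exists_eq_one_add_smul_map
    hk hgk hn hg

/-- **Minkowski, number-field form** (`IsOfFinOrder`): `g ≡ 1 (mod n)` integrally, of finite order,
`n ≥ 3` ⟹ `g = 1`. [cite: Minkowski1887, §1] -/
theorem IsCongruentOneMod.eq_one_of_isOfFinOrder {n : ℕ} (hn : 3 ≤ n) {g : Matrix m m E}
    (hg : IsCongruentOneMod n g) (hfin : IsOfFinOrder g) : g = 1 := by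
  obtain ⟨k, hk, hgk⟩ := isOfFinOrder_iff_pow_eq_one.1 hfin
  exact hg.eq_one_of_pow_eq_one hn hk hgk

/-- **The principal congruence subgroup `Γ(n)` of `U(H)(E)` is torsion-free for `n ≥ 3`** (the
`torsionFree` clause of `UnitaryBallQuotientDatum` for `Γ = Γ(n)`).
[cite: Minkowski1887, §1] [cite: BergeronMillsonMoeglin2016Balls, Part 2 §1.4] -/
theorem torsionFree_principalCongruenceSubgroup (σ : E →+* E) (H : Matrix m m E) {n : ℕ}
    (hn : 3 ≤ n) : ∀ γ ∈ principalCongruenceSubgroup σ H n, IsOfFinOrder γ → γ = 1 := by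
  intro γ hγ hfin
  obtain ⟨-, hc, -⟩ := hγ
  have hfin' : IsOfFinOrder (γ : Matrix m m E) := Units.isOfFinOrder_val.2 hfin
  exact Units.ext (hc.eq_one_of_isOfFinOrder hn hfin')

/-- **Subgroups of `Γ(n)`, `n ≥ 3`, are torsion-free** (e.g. the arithmetic groups `Γ = U(V)(F) ∩ K`
with `K ⊆ K(n)`). [cite: Minkowski1887, §1] [cite: BergeronMillsonMoeglin2016Balls, Part 2 §1.4] -/
theorem torsionFree_of_le_principalCongruenceSubgroup {σ : E →+* E} {H : Matrix m m E} {n : ℕ}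
    (hn : 3 ≤ n) {Γ : Subgroup (GL m E)} (hΓ : Γ ≤ principalCongruenceSubgroup σ H n) :
    ∀ γ ∈ Γ, IsOfFinOrder γ → γ = 1 := fun γ hγ hfin =>
  torsionFree_principalCongruenceSubgroup σ H hn γ (hΓ hγ) hfin

end Literature.AlgebraicGeometry.ShimuraVarieties
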